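import Summits.CriticalPhenomena.SAWScalingLimit.Theorems.SimpleSubseqLimits.Negative.SimpleSubseqLimitsSimpleNotClosed

/-!
# Negative-side results for the crux `SAWLoopFugacityFlow.SimpleSubseqLimits` (stmt-CriticalPhenomena-4982):
ORDER IS BLIND TO KISSES — the marked-point "no revisit" clause of the picked line
`marked-point-revisit` holds at a NON-simple limit of simple curves (work-file §15, gen 3)

The line `Cruxes/SimpleSubseqLimits/Lines/marked-point-revisit.lean` splits the crux into SHAPE
(`RangeIsArc`, fed by the route's open rank-2 crux `AvoidanceLimit`) and ORDER (`NoMarkedRevisitFor ν`: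
on a dense set of parameters `(z, ρ, R)`, `ν`-a.e. class has a representative that never returns,
after its first hit `T` of `closedBall z ρ`, to the marked entrance point `γ lam ∈ sphere z R`), the
latter delivered by the lattice input `OnePointNoTouch` through the limit passage `stub_noMarkedRevisit`.
This file shows that ORDER ALONE never yields simplicity, even on limits of simple curves: the Dirac
mass at the KISS class — the polygon `0 → 2 → 2+i → 1 → i`, which comes back and touches its first
edge at the single point `1` from above (one pair of double times `1/8, 3/4`; no retrace, no crossing)
— satisfies `NoMarkedRevisitFor` (an exact marked revisit needs the marked point to be the kiss point,
i.e. `dist 1 z = R`, a nowhere dense parameter set), is a limit of simple classes (the injective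
polygons `kissAt h`, `h ↓ 0`), and is not simple. Mirror image of `SimpleSubseqLimitsRangeBlind`
(SHAPE without ORDER fails); together: in that line the A-side input is load-bearing for SIMPLICITY
itself — transversal crossings are not limits of simple planar curves, retraces are caught by ORDER,
kisses only by SHAPE (a kiss range contains a loop, so it is not an arc).

`MarkedConfig` and `NoMarkedRevisitFor` are VERBATIM the registered skeleton's predicates
(namespace `…Cruxes.SimpleSubseqLimits.MarkedPointRevisit`, skeleton sha 909bc12e…), copied here so
that the file is self-contained. Refuter `cdisprove` gen 3; indexed work file
`Summits/CriticalPhenomena/SAWScalingLimit/Cruxes/SimpleSubseqLimits/Disproof.lean` §15.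
-/

noncomputable section

open MeasureTheory Filter Topology Set Metric
open Literature.Probability.RandomPlanarGeometry
open scoped unitInterval

namespace Summit.CriticalPhenomena.SAWScalingLimit.Theorems.SimpleSubseqLimits.Negative

/-- VERBATIM the line's `MarkedConfig` (marked first-hit configuration: `T` the first hitting time of
`closedBall z ρ`, `lam < T` an entrance time into `closedBall z R` after which the curve stays there up
to `T`; the marked point is `γ lam ∈ sphere z R`) — a predicate of the skeleton, not a literature fact. -/
def MarkedConfig (γ : Curve ℂ) (z : ℂ) (ρ R : ℝ) (lam T : I) : Prop :=
  lam < T ∧ γ lam ∈ sphere z R ∧ (∀ u : I, lam ≤ u → u ≤ T → γ u ∈ closedBall z R) ∧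
    γ T ∈ closedBall z ρ ∧ ∀ u : I, u < T → γ u ∉ closedBall z ρ

/-- VERBATIM the line's `NoMarkedRevisitFor` (the ORDER clause at the limit level: a dense parameter
set on which a.e. class has a representative with no exact marked revisit) — a predicate of the
skeleton, not a literature fact. -/
def NoMarkedRevisitFor (ν : Measure (CurveClass ℂ)) : Prop :=
  ∃ S : Set (ℂ × ℝ × ℝ), Dense S ∧
    ∀ᵐ c ∂ν, ∃ γ : Curve ℂ, CurveClass.mk γ = c ∧
      ∀ p ∈ S, ∀ lam T : I, MarkedConfig γ p.1 p.2.1 p.2.2 lam T →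
        ∀ t' : I, T < t' → γ t' ≠ γ lam

/-- Real profile of the `x`-coordinate of the kiss curves: `0 → 2` on `[0, 1/4]`, `2` on
`[1/4, 1/2]`, `2 → 0` on `[1/2, 1]`. -/
def kissX (t : ℝ) : ℝ := min (min (8 * t) 2) (4 - 4 * t)

/-- Real profile of the `y`-coordinate of the kiss curve with touch height `h`: `0` on `[0, 1/4]`,
`0 → 1` on `[1/4, 1/2]`, the `V`-shape `1 → h → 1` on `[1/2, 1]` with its minimum `h` at `t = 3/4`. -/
def kissY (h t : ℝ) : ℝ := max 0 (min (4 * t - 1) (h + (1 - h) * |4 * t - 3|))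

/-- The `x`-profile is continuous. [folklore] -/
theorem continuous_kissX : Continuous kissX := by unfold kissX; fun_prop

/-- The `y`-profile is continuous. [folklore] -/
theorem continuous_kissY (h : ℝ) : Continuous (kissY h) := by unfold kissY; fun_prop

/-- **The kiss curves** `kissAt h`, polygonal through `0, 2, 2 + i, 1 + h i, i`: for `0 < h < 1`
an INJECTIVE polygon; for `h = 0` the fourth vertex `1` lies on the first edge `[0, 2]` — the curve
comes back, TOUCHES its past at the single point `1` from above and leaves upwards (a *kiss*: one
double point, no retracing, no crossing). -/
def kissAt (h : ℝ) : Curve ℂ :=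
  ⟨⟨fun t => ((kissX t : ℝ) : ℂ) + Complex.I * ((kissY h t : ℝ) : ℂ), by
    have := continuous_kissX; have := continuous_kissY h; fun_prop⟩⟩

/-- The kiss curve (touch height `0`). -/
def kiss : Curve ℂ := kissAt 0

/-- Pointwise formula. [folklore] -/
@[simp] theorem kissAt_apply (h : ℝ) (t : I) :
    kissAt h t = ((kissX t : ℝ) : ℂ) + Complex.I * ((kissY h t : ℝ) : ℂ) := rfl

/-- Real part of the kiss curves. [folklore] -/
theorem kissAt_re (h : ℝ) (t : I) : (kissAt h t).re = kissX t := by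
  simp [Complex.add_re, Complex.mul_re]

/-- Imaginary part of the kiss curves. [folklore] -/
theorem kissAt_im (h : ℝ) (t : I) : (kissAt h t).im = kissY h t := by
  simp [Complex.add_im, Complex.mul_im]

/-- Piece formula of the profiles. [folklore] -/
theorem kissX_of_le {t : ℝ} (ht : t ≤ 1 / 4) : kissX t = 8 * t := by
  unfold kissX
  rw [min_eq_left (by linarith : 8 * t ≤ 2), min_eq_left (by linarith : 8 * t ≤ 4 - 4 * t)]

/-- Piece formula of the profiles. [folklore] -/
theorem kissX_of_mem {t : ℝ} (h₁ : 1 / 4 ≤ t) (h₂ : t ≤ 1 / 2) : kissX t = 2 := by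
  unfold kissX
  rw [min_eq_right (by linarith : 2 ≤ 8 * t), min_eq_left (by linarith : (2 : ℝ) ≤ 4 - 4 * t)]

/-- Piece formula of the profiles. [folklore] -/
theorem kissX_of_ge {t : ℝ} (ht : 1 / 2 ≤ t) : kissX t = 4 - 4 * t := by
  unfold kissX
  exact min_eq_right (le_min (by linarith) (by linarith))

/-- Piece formula of the profiles. [folklore] -/
theorem kissY_of_le (h : ℝ) {t : ℝ} (ht : t ≤ 1 / 4) : kissY h t = 0 := by
  unfold kissY
  exact max_eq_left ((min_le_left _ _).trans (by linarith))

/-- Piece formula of the profiles. [folklore] -/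
theorem kissY_of_mem {h t : ℝ} (hh : h ≤ 1) (h₁ : 1 / 4 ≤ t) (h₂ : t ≤ 1 / 2) :
    kissY h t = 4 * t - 1 := by
  unfold kissY
  have habs : |4 * t - 3| = 3 - 4 * t := by
    rw [abs_of_nonpos (by linarith)]; ring
  rw [habs, min_eq_left (by nlinarith), max_eq_right (by linarith)]

/-- Piece formula of the profiles. [folklore] -/
theorem kissY_of_ge {h t : ℝ} (hh₀ : 0 ≤ h) (hh : h ≤ 1) (h₁ : 1 / 2 ≤ t) (h₂ : t ≤ 1) :
    kissY h t = h + (1 - h) * |4 * t - 3| := by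
  unfold kissY
  have habs : |4 * t - 3| ≤ 1 := abs_le.2 ⟨by linarith, by linarith⟩
  have hnn : 0 ≤ (1 - h) * |4 * t - 3| := mul_nonneg (by linarith) (abs_nonneg _)
  rw [min_eq_right (by nlinarith), max_eq_right (by linarith)]

/-- **The double points of the kiss curves.** For `0 ≤ h < 1`, `kissAt h s = kissAt h t` with
`s < t` forces `h = 0`, `s = 1/8`, `t = 3/4`: the polygon `kissAt h` is injective for `h > 0`, and
`kiss = kissAt 0` has exactly ONE pair of double times, `kiss (1/8) = kiss (3/4) = 1`. [folklore] -/
theorem kissAt_eq_kissAt {h : ℝ} (hh₀ : 0 ≤ h) (hh₁ : h < 1) {s t : I} (hst : s < t)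
    (heq : kissAt h s = kissAt h t) : h = 0 ∧ (s : ℝ) = 1 / 8 ∧ (t : ℝ) = 3 / 4 := by
  have hx : kissX s = kissX t := by simpa [kissAt_re] using congrArg Complex.re heq
  have hy : kissY h s = kissY h t := by simpa [kissAt_im] using congrArg Complex.im heq
  have hs0 := s.2.1; have hs1 := s.2.2; have ht0 := t.2.1; have ht1 := t.2.2
  have hst' : (s : ℝ) < t := hst
  rcases le_or_gt (t : ℝ) (1 / 2) with ht | ht
  · rcases lt_or_ge (s : ℝ) (1 / 4) with hs | hs
    · rw [kissX_of_le hs.le] at hx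
      rcases le_or_gt (t : ℝ) (1 / 4) with ht' | ht'
      · rw [kissX_of_le ht'] at hx; exact absurd hx (by linarith)
      · rw [kissX_of_mem ht'.le ht] at hx; exact absurd hx (by linarith)
    · rw [kissY_of_mem hh₁.le hs (hst'.le.trans ht), kissY_of_mem hh₁.le (hs.trans hst'.le) ht] at hy
      exact absurd hy (by linarith)
  · rcases lt_or_ge (s : ℝ) (1 / 2) with hs | hs
    · rw [kissX_of_ge ht.le] at hx
      have hs4 : (s : ℝ) < 1 / 4 := by
        by_contra hcon
        rw [kissX_of_mem (not_lt.1 hcon) hs.le] at hx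
        linarith
      rw [kissX_of_le hs4.le] at hx
      rw [kissY_of_le h hs4.le, kissY_of_ge hh₀ hh₁.le ht.le ht1] at hy
      have habs : 0 ≤ |4 * (t : ℝ) - 3| := abs_nonneg _
      have h1h : 0 < 1 - h := by linarith
      have hprod : 0 ≤ (1 - h) * |4 * (t : ℝ) - 3| := mul_nonneg h1h.le habs
      have hh : h = 0 := by linarith
      have habs0 : |4 * (t : ℝ) - 3| = 0 := by
        have : (1 - h) * |4 * (t : ℝ) - 3| = 0 := by linarith
        rcases mul_eq_zero.1 this with h' | h'
        · exact absurd h' h1h.ne'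
        · exact h'
      have ht34 : (t : ℝ) = 3 / 4 := by
        have := abs_eq_zero.1 habs0; linarith
      exact ⟨hh, by rw [ht34] at hx; linarith, ht34⟩
    · rw [kissX_of_ge hs, kissX_of_ge ht.le] at hx
      exact absurd hx (by linarith)

/-- For `0 < h < 1` the kiss polygon is a simple curve. [folklore] -/
theorem kissAt_isSimple {h : ℝ} (hh₀ : 0 < h) (hh₁ : h < 1) : (kissAt h).IsSimple := by
  intro s t heq
  rcases lt_trichotomy s t with hst | hst | hst
  · exact absurd (kissAt_eq_kissAt hh₀.le hh₁ hst heq).1 hh₀.ne'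
  · exact hst
  · exact absurd (kissAt_eq_kissAt hh₀.le hh₁ hst heq.symm).1 hh₀.ne'

/-- The double times of the kiss curve. [folklore] -/
theorem kiss_eq_kiss {s t : I} (hst : s < t) (heq : kiss s = kiss t) :
    (s : ℝ) = 1 / 8 ∧ (t : ℝ) = 3 / 4 :=
  (kissAt_eq_kissAt le_rfl one_pos hst heq).2

/-- The kiss point: `kiss s = 1` whenever `s = 1/8`. [folklore] -/
theorem kiss_apply_of_eq {s : I} (hs : (s : ℝ) = 1 / 8) : kiss s = 1 := by
  apply Complex.ext
  · rw [kiss, kissAt_re, kissX_of_le (by rw [hs]; norm_num), hs]; norm_num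
  · rw [kiss, kissAt_im, kissY_of_le 0 (by rw [hs]; norm_num)]; norm_num

/-- The kiss curve is not flat: `kiss (1/8) = kiss (3/4) = 1` but `kiss (1/2) = 2 + i`. [folklore] -/
theorem kiss_not_isFlat : ¬ kiss.IsFlat := by
  intro hfl
  have hs : ((1 : ℝ) / 8) ∈ I := ⟨by norm_num, by norm_num⟩
  have hu : ((1 : ℝ) / 2) ∈ I := ⟨by norm_num, by norm_num⟩
  have ht : ((3 : ℝ) / 4) ∈ I := ⟨by norm_num, by norm_num⟩
  have h1 : kiss ⟨_, hs⟩ = 1 := kiss_apply_of_eq rfl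
  have h2 : kiss ⟨_, ht⟩ = 1 := by
    apply Complex.ext
    · rw [kiss, kissAt_re, kissX_of_ge (by norm_num)]; norm_num
    · rw [kiss, kissAt_im, kissY_of_ge le_rfl zero_le_one (by norm_num) (by norm_num)]; norm_num
  have key := hfl ⟨_, hs⟩ ⟨_, hu⟩ ⟨_, ht⟩ (Subtype.mk_le_mk.2 (by norm_num))
    (Subtype.mk_le_mk.2 (by norm_num)) (h1.trans h2.symm)
  have := congrArg Complex.re key
  rw [h1, kiss, kissAt_re, kissX_of_mem (by norm_num) (by norm_num)] at this
  norm_num at this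

/-- **The class of the kiss curve is not simple** (only flat curves have simple classes). [folklore] -/
theorem mk_kiss_not_mem_simple : CurveClass.mk kiss ∉ CurveClass.simple := fun h =>
  kiss_not_isFlat (isFlat_of_mk_mem_simple h)

/-- The kiss polygons are uniformly `h`-close to the kiss curve (`0 ≤ h ≤ 1`). [folklore] -/
theorem dist_kissAt_kiss_le {h : ℝ} (hh₀ : 0 ≤ h) (hh₁ : h ≤ 1) : dist (kissAt h) kiss ≤ h := by
  refine (Curve.dist_le_dist_toContinuousMap _ _).trans ?_
  refine (ContinuousMap.dist_le hh₀).2 fun t => ?_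
  change dist (kissAt h t) (kiss t) ≤ h
  rw [kiss, kissAt_apply, kissAt_apply, Complex.dist_eq, add_sub_add_left_eq_sub, ← mul_sub,
    norm_mul, Complex.norm_I, one_mul, ← Complex.ofReal_sub, Complex.norm_real, Real.norm_eq_abs]
  rcases le_or_gt (t : ℝ) (1 / 2) with ht | ht
  · rcases le_or_gt (t : ℝ) (1 / 4) with ht' | ht'
    · rw [kissY_of_le h ht', kissY_of_le 0 ht']; simpa using hh₀
    · rw [kissY_of_mem hh₁ ht'.le ht, kissY_of_mem zero_le_one ht'.le ht]; simpa using hh₀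
  · rw [kissY_of_ge hh₀ hh₁ ht.le t.2.2, kissY_of_ge le_rfl zero_le_one ht.le t.2.2]
    have habs : |4 * (t : ℝ) - 3| ≤ 1 := abs_le.2 ⟨by linarith [t.2.2], by linarith [t.2.2]⟩
    have habs0 : 0 ≤ |4 * (t : ℝ) - 3| := abs_nonneg _
    rw [abs_le]
    constructor <;> nlinarith

/-- The simple classes `mk (kissAt (1/(n+2)))` converge to the kiss class. [folklore] -/
theorem tendsto_mk_kissAt :
    Tendsto (fun n : ℕ => CurveClass.mk (kissAt (1 / ((n : ℝ) + 2)))) atTop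
      (𝓝 (CurveClass.mk kiss)) := by
  rw [tendsto_iff_dist_tendsto_zero]
  have h2 : Tendsto (fun n : ℕ => 1 / ((n : ℝ) + 2)) atTop (𝓝 0) := by
    have := tendsto_one_div_add_atTop_nhds_zero_nat (𝕜 := ℝ)
    refine squeeze_zero (fun n => by positivity) (fun n => ?_) this
    exact one_div_le_one_div_of_le (by positivity) (by linarith)
  refine squeeze_zero (fun _ => dist_nonneg) (fun n => ?_) h2
  rw [CurveClass.dist_mk_mk]
  exact dist_kissAt_kiss_le (by positivity) (by
    rw [div_le_one (by positivity)]; linarith [n.cast_nonneg (α := ℝ)])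

/-- The kiss class is a limit of SIMPLE classes (so `simple` is not closed, re-derived with a kiss
instead of the retrace of §4) — it is the kind of non-simple class a weak limit of self-avoiding
polygons can charge. [folklore] -/
theorem mk_kiss_mem_closure_simple : CurveClass.mk kiss ∈ closure CurveClass.simple := by
  refine mem_closure_of_tendsto tendsto_mk_kissAt (Eventually.of_forall fun n => ?_)
  refine CurveClass.mk_mem_simple (kissAt_isSimple (by positivity) ?_)
  rw [div_lt_one (by positivity)]; linarith [n.cast_nonneg (α := ℝ)]

/-- The parameter set off the single sphere through the kiss point: `{(z, ρ, R) | dist 1 z ≠ R}`. -/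
def kissParams : Set (ℂ × ℝ × ℝ) := {p | dist (1 : ℂ) p.1 ≠ p.2.2}

/-- The good parameter set is dense (perturb the radius `R`). [folklore] -/
theorem dense_kissParams : Dense kissParams := by
  intro x
  rw [Metric.mem_closure_iff]
  intro ε hε
  by_cases hx : x ∈ kissParams
  · exact ⟨x, hx, by rwa [dist_self]⟩
  · have hx' : dist (1 : ℂ) x.1 = x.2.2 := not_ne_iff.1 hx
    refine ⟨(x.1, x.2.1, x.2.2 + ε / 2), ?_, ?_⟩
    · show dist (1 : ℂ) x.1 ≠ x.2.2 + ε / 2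
      rw [hx']; linarith
    · rw [Prod.dist_eq, Prod.dist_eq, dist_self, dist_self, Real.dist_eq]
      rw [show x.2.2 - (x.2.2 + ε / 2) = -(ε / 2) by ring, abs_neg, abs_of_pos (half_pos hε)]
      rw [max_eq_right (half_pos hε).le, max_eq_right (half_pos hε).le]
      linarith

/-- **The kiss has no marked revisit at any parameter off one sphere.** An exact marked revisit
`kiss t' = kiss lam`, `lam < T < t'`, needs the double pair `(lam, t') = (1/8, 3/4)`, whose marked
point is the kiss point `1`, which lies on `sphere z R` only when `dist 1 z = R`. [folklore] -/
theorem kiss_noMarkedRevisit {p : ℂ × ℝ × ℝ} (hp : p ∈ kissParams) {lam T : I}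
    (hM : MarkedConfig kiss p.1 p.2.1 p.2.2 lam T) {t' : I} (hT : T < t') : kiss t' ≠ kiss lam := by
  intro heq
  have hlt : lam < t' := hM.1.trans hT
  obtain ⟨hlam, -⟩ := kiss_eq_kiss hlt heq.symm
  have hsph := hM.2.1
  rw [kiss_apply_of_eq hlam, Metric.mem_sphere] at hsph
  exact hp hsph

/-- `NoMarkedRevisitFor` (the ORDER clause delivered by stubs 4–5 of the line) HOLDS for the Dirac
mass at the kiss class. [folklore] -/
theorem noMarkedRevisitFor_dirac_kiss : NoMarkedRevisitFor (Measure.dirac (CurveClass.mk kiss)) := by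
  refine ⟨kissParams, dense_kissParams, ?_⟩
  rw [ae_dirac_eq, eventually_pure]
  exact ⟨kiss, rfl, fun p hp lam T hM t' hT => kiss_noMarkedRevisit hp hM hT⟩

/-- **ORDER WITHOUT SHAPE IS INSUFFICIENT (mirror of §7).** A probability measure on curve classes
satisfying the line's ORDER clause `NoMarkedRevisitFor`, carried by limits of simple classes, yet
giving mass `0` to `simple`: the Dirac mass at the kiss. The marked-point functional never sees a
KISS (a double point that is neither a retrace nor a crossing); only SHAPE (`HasArcRange`: the range
of a kiss contains a loop, so it is not an arc) excludes it. Since transversal CROSSINGS cannot arise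
as uniform limits of simple planar curves but kisses and retraces can, the non-simple classes a
subsequential SAW limit may charge are retraces (caught by ORDER) and kisses (caught by SHAPE only):
in the line `marked-point-revisit` the A-side input `RangeIsArc` is load-bearing for SIMPLICITY
itself, not only for the boundary clause — if `AvoidanceLimit` does not close, `OnePointNoTouch`-type
inputs cannot rescue the simplicity half of the crux. [folklore] -/
theorem exists_noMarkedRevisitFor_not_ae_simple :
    ∃ ν : Measure (CurveClass ℂ), IsProbabilityMeasure ν ∧ NoMarkedRevisitFor ν ∧
      (∀ᵐ c ∂ν, c ∈ closure CurveClass.simple) ∧ ∀ᵐ c ∂ν, c ∉ CurveClass.simple :=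
  ⟨Measure.dirac (CurveClass.mk kiss), inferInstance, noMarkedRevisitFor_dirac_kiss,
    by rw [ae_dirac_eq, eventually_pure]; exact mk_kiss_mem_closure_simple,
    by rw [ae_dirac_eq, eventually_pure]; exact mk_kiss_not_mem_simple⟩

/-- The a.e.-simplicity conclusion of the crux FAILS for this ORDER-satisfying measure. [folklore] -/
theorem not_ae_simple_dirac_kiss :
    ¬ ∀ᵐ c ∂(Measure.dirac (CurveClass.mk kiss)), c ∈ CurveClass.simple := by
  rw [ae_dirac_eq, eventually_pure]
  exact mk_kiss_not_mem_simple

end Summit.CriticalPhenomena.SAWScalingLimit.Theorems.SimpleSubseqLimits.Negative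

end
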